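import Mathlib.Analysis.SpecialFunctions.Integrals.Basic
import Mathlib.MeasureTheory.Integral.DominatedConvergence

/-!
# The error function `erf` and its Maclaurin series

`erf x = (2/√π) ∫₀ˣ e^{−t²} dt` [cite: DLMF, §7.2(i) eq. 7.2.1]; the Maclaurin series
`∫₀ˣ e^{−t²} dt = Σ_{k≥0} (−1)^k x^{2k+1} / (k! (2k+1))` (so `erf x = (2/√π)·Σ …`)
[cite: DLMF, §7.6(i) eq. 7.6.1], proved by termwise integration of the exponential series (dominated
convergence); monotonicity on `[0, ∞)` from the positivity of the integrand in 7.2.1. A kernel-evaluable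
interval enclosure built on these lives cell-side (`Summits/Ventures/LatticeEstimator/Numerics/IntervalErf.lean`).
-/

noncomputable section

open Finset MeasureTheory

namespace Literature.Analysis.SpecialFunctions

/-! ### The error function and its Maclaurin series -/

/-- The error function `erf x = (2/√π) ∫₀ˣ e^{−t²} dt`. [cite: DLMF, §7.2(i) eq. 7.2.1] -/
def erf (x : ℝ) : ℝ := 2 / Real.sqrt Real.pi * ∫ t in (0 : ℝ)..x, Real.exp (-(t ^ 2))

/-- The Maclaurin coefficients `a_k(x) = x^{2k+1} / (k! (2k+1))` of `(√π/2)·erf`.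
[cite: DLMF, §7.6(i) eq. 7.6.1] -/
def erfTerm (x : ℝ) (k : ℕ) : ℝ := x ^ (2 * k + 1) / ((k.factorial : ℝ) * (2 * k + 1))

/-- **Maclaurin series of the Gaussian integral**: `∫₀ˣ e^{−t²} dt = Σ (−1)^k x^{2k+1}/(k!(2k+1))`
for `x ≥ 0` (termwise integration of the exponential series, dominated convergence).
[cite: DLMF, §7.6(i) eq. 7.6.1] -/
theorem hasSum_integral_exp_neg_sq {x : ℝ} (hx : 0 ≤ x) :
    HasSum (fun k : ℕ => (-1 : ℝ) ^ k * erfTerm x k) (∫ t in (0 : ℝ)..x, Real.exp (-(t ^ 2))) := by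
  have key := intervalIntegral.hasSum_integral_of_dominated_convergence
    (μ := volume) (a := 0) (b := x) (F := fun k t => (-1 : ℝ) ^ k / k.factorial * t ^ (2 * k))
    (f := fun t => Real.exp (-(t ^ 2))) (fun k _ => x ^ (2 * k) / k.factorial) ?_ ?_ ?_ ?_ ?_
  · have e : (fun k : ℕ => ∫ t in (0 : ℝ)..x, (-1 : ℝ) ^ k / k.factorial * t ^ (2 * k)) =
        (fun k : ℕ => (-1 : ℝ) ^ k * erfTerm x k) := by
      funext k
      rw [intervalIntegral.integral_const_mul, integral_pow]
      unfold erfTerm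
      rw [zero_pow (by omega), sub_zero]
      push_cast
      field_simp
    rw [e] at key
    exact key
  · intro k
    exact (by fun_prop : Continuous fun t : ℝ => (-1 : ℝ) ^ k / k.factorial * t ^ (2 * k)).aestronglyMeasurable
  · intro k
    refine ae_of_all _ fun t ht => ?_
    rw [Set.uIoc_of_le hx, Set.mem_Ioc] at ht
    rw [norm_mul, norm_div, norm_pow, norm_neg, norm_one, one_pow, Real.norm_natCast, norm_pow,
      Real.norm_eq_abs, abs_of_pos ht.1, one_div, div_eq_mul_inv, mul_comm]
    gcongr
    · exact ht.1.le
    · exact ht.2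
  · refine ae_of_all _ fun t _ => ?_
    have := NormedSpace.expSeries_div_summable (x ^ 2)
    simpa [pow_mul] using this
  · exact intervalIntegrable_const
  · refine ae_of_all _ fun t _ => ?_
    have h := NormedSpace.expSeries_div_hasSum_exp (-(t ^ 2))
    rw [← congrFun Real.exp_eq_exp_ℝ (-(t ^ 2))] at h
    have e : (fun n : ℕ => (-(t ^ 2)) ^ n / (n.factorial : ℝ)) =
        (fun k : ℕ => (-1 : ℝ) ^ k / k.factorial * t ^ (2 * k)) := by
      funext k
      rw [neg_pow, pow_mul]
      ring
    rw [e] at h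
    exact h

/-- `erf` is monotone on `[0, ∞)`: the integrand `e^{−t²}` of 7.2.1 is positive. [cite: DLMF, §7.2(i) eq. 7.2.1] -/
theorem erf_le_erf {a b : ℝ} (ha : 0 ≤ a) (hab : a ≤ b) : erf a ≤ erf b := by
  unfold erf
  have hc : 0 ≤ 2 / Real.sqrt Real.pi := by positivity
  apply mul_le_mul_of_nonneg_left _ hc
  apply intervalIntegral.integral_mono_interval le_rfl ha hab
  · exact Filter.Eventually.of_forall fun t => (Real.exp_pos _).le
  · exact (by fun_prop : Continuous fun t : ℝ => Real.exp (-(t ^ 2))).intervalIntegrable _ _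

end Literature.Analysis.SpecialFunctions

end
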